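import Summits.AtomisticToContinuum.HydrodynamicLimit.Theorems.RelayRaceLocalityNearConstantShortTimeHLAssemblyDefs
import Summits.AtomisticToContinuum.HydrodynamicLimit.Theorems.RelayRaceLocalityNearConstantShortTimeHLAssemblyTheta
import Summits.AtomisticToContinuum.HydrodynamicLimit.Theorems.RelayRaceLocalityNearConstantShortTimeHLSmallTiltDefs
import HarnessLib

/-!
# Crux `NearConstantShortTimeHL` (stmt-AtomisticToContinuum-12502), line `small-tilt-domination` — the FOURTH-MOMENT CAP:
# re-typed closure inputs S2″/S3″, the a-priori input S4d, and the dynamic theorem with the extra cap (typed statements, lead c7)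

Reviewed Defs file of the line (skeleton v14, lead prover-line-stmt-AtomisticToContinuum-12502-c7-0). WHY: the closure inputs
`MomentumClosureTightnessUR` / `EnergyClosureTightnessUR` (S2/S3 of skeletons v2–v13, `…SmallTiltDefs`) ask for ONE large-deviation
rate `c₀(M)` under the invariant drifted Gibbs law, fixed BEFORE the window `[s, s+τ]`, the test and the defect size `δ` (the rate that
`good_event_package` consumes on the diagonal grid `t/ι_N` with thresholds `2Λ/(ι_N+1)²`). At the physics level of large-deviation
pricing this is FALSE as typed: the refuter's "vacuum-gap needle beam" equilibrium fluctuation against `MomentumClosureCost`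
(stmt-14424, evidence `SUSPECT-FALSE-14424.md`, 2026-08-16) SCALES with the window — a vacuum slab of width `≍ τ√θ` protected for the
window costs `≍ C₁ τ n`, interleaved cold counter-streaming sheets at half the cap speed `n^{1/24}/2` carrying a momentum-flux defect `δ`
over the window cost `≍ 1.5 δ n/(θτ) + o(n)` (mass fraction `12 δ n^{-1/12}/τ → 0`, so their sub-`ℓ_n` phase-space localisation is `o(n)`);
with `δ = τ²` the rate is `O(τ) → 0`, below every fixed `c₀`. The speed cap and the ball-packing cap do not see the beams. REPAIR (the
refuter's `C′`): add the FOURTH-MOMENT CAP `n⁻¹ Σᵢ ‖vᵢ(r)‖⁴ ≤ K` on the window to the conditioning event. It forces a beam mass fraction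
`≥ 9δ²/(Kτ²)` (kinetic budget `f V² = 3δ/τ` against `f V⁴ ≤ K`), whose localisation below the ball scale then costs
`≥ (4.5 δ²/(Kτ²)) n log n` — superlinear, hence consistent with any fixed rate eventually in `N` (`N₀` may depend on `τ, δ`); rarefied
collisionless pockets without fine tuning are killed by the speed cap as before. The matching a-priori input along the TRUE law is (d)
`FourthMomentCapPreShock`: the empirical fourth velocity moment stays below every strict bound of the Euler fourth moment
`‖u‖⁴ + 10θ‖u‖² + 15θ²` on `[0,t]`, with probability `→ 1` (pre-shock LLN upper bound for the quartic moment; same family as the speed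
cap 9511 and the packing cap 14425; not transferable from equilibrium).

Contents (statements only, no mathematics): `momentCapOn`; `MomentumClosureTightness4` (S2″), `EnergyClosureTightness4` (S3″) — the
frames of S2/S3 verbatim in the compact vocabulary of `…AssemblyTheta` (`speedCapOn`, `packCapOn`, `momDefect`, `enDefect`) with the
extra conjunct `momentCapOn … K` and the rate chosen after `(M, K)`; `FourthMomentCapPreShock` (S4d); `DynamicTheorem4` — `DynamicTheorem`
(`…DynamicDefs`) with the cap-failure hypothesis `hcapM` added and the fourth-moment cap inside the events of `hKmom` / `hKen`.
PROVED (sanity of the re-typing): `momentumClosureTightness4_of_UR`, `energyClosureTightness4_of_UR` — the old K-stubs imply the new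
ones (smaller event, rate independent of `K`), so skeleton v14 asks for LESS than v13 on the equilibrium side.
References: H.-T. Yau, Lett. Math. Phys. 22 (1991) §2; C. Kipnis – C. Landim (1999) Ch. 10 Thm 3.1 (stochastic template).
-/

noncomputable section

namespace Summit.AtomisticToContinuum.HydrodynamicLimit.Theorems.NearConstantShortTimeHL

open scoped BigOperators ENNReal
open MeasureTheory Set Filter Topology
open Literature.MathematicalPhysics.KineticTheory Literature.Analysis.FluidPDE Literature.Analysis.FunctionSpaces

variable {ε : ℝ} {n : ℕ}

/-- The FOURTH-MOMENT CAP along an orbit: `n⁻¹ Σᵢ ‖vᵢ(r)‖⁴ ≤ K` for all `r ∈ S`. [folklore] -/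
def momentCapOn (Φ : HardSphereFlow (Torus.geometry (Fin 3)) ε n) (z : Config n (Fin 3) T3) (S : Set ℝ) (K : ℝ) : Prop :=
  ∀ r ∈ S, (n : ℝ)⁻¹ * ∑ i, ‖((Φ.flow r z) i).2‖ ^ 4 ≤ K

/-- **S2″ — MOMENTUM CLOSURE TIGHTNESS AT A UNIFORM RATE UNDER THE FOURTH-MOMENT CAP** (K-stub of skeleton v14; OPEN,
delegated-grade). The frame of `MomentumClosureTightnessUR` (general families, drifted constant reference `(ā, ū, θe)` in the `M`-box,
windows `[s, s+τ] ⊆ [0,1]`, vector tests normalised in `C¹`, ball averages at `ℓ_n = n^{-1/4}`, speed cap `n^{1/24}` and ball-packing cap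
`η₁` INSIDE the event) with ONE change: the conditioning event also carries the fourth-moment cap `n⁻¹ Σᵢ ‖vᵢ(r)‖⁴ ≤ K` on the window, and
the rate `c₀ > 0` is chosen after `M` and the cap level `K` (and before the reference state, `σ`, the window, the test and the defect
size `δ`). Cheap witnesses: sub-`ℓ_n` shear / sound / thermal patterns decay in `≤ n^{-1/6} ≪ τ`; hot bursts inside the speed cap
thermalise in `n^{-3/8}`; vacuum-protected needle beams need mass fraction `≥ 9δ²/(Kτ²)` under the cap and then cost `≳ δ²/(Kτ²)·n log n`
(superlinear); rarefied collisionless pockets carry flux `O(ε)` under the speed cap. [cite: Yau1991, §2] -/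
@[conjecture] def MomentumClosureTightness4 : Prop :=
  ∃ η₁ : ℝ, 0 < η₁ ∧ ∀ M : ℝ, 1 ≤ M → ∀ K : ℝ, 0 < K → ∃ c₀ : ℝ, 0 < c₀ ∧ ∀ (abar θe : ℝ) (ubar : V3),
    M⁻¹ ≤ abar → abar ≤ M → M⁻¹ ≤ θe → θe ≤ M → ‖ubar‖ ≤ M →
    ∃ σ₀ : ℝ, 0 < σ₀ ∧ ∀ σ : ℝ, 0 < σ → σ < σ₀ →
    ∀ (ε : ℕ → ℝ) (n : ℕ → ℕ), (∀ N, 0 < ε N) → Tendsto ε atTop (nhds 0) →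
    Tendsto (fun N => (n N : ℝ) * ε N ^ 3) atTop (nhds (σ ^ 3)) →
    ∀ Φ : (N : ℕ) → HardSphereFlow (Torus.geometry (Fin 3)) (ε N) (n N),
    ∀ (s τ : ℝ), 0 ≤ s → 0 < τ → s + τ ≤ 1 →
    ∀ ψ : ℝ → T3 → V3, Torus.IsSmoothSpaceTimeOn (Set.Icc s (s + τ)) ψ →
    (∀ r ∈ Set.Icc s (s + τ), ∀ x, ‖ψ r x‖ ≤ 1 ∧ ‖Torus.timeDerivWithin (Set.Icc s (s + τ)) ψ r x‖ ≤ 1 ∧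
      ∀ i, ‖Torus.partialDeriv i (ψ r) x‖ ≤ 1) →
    ∀ δ : ℝ, 0 < δ → ∀ᶠ N : ℕ in atTop,
      particleLaw (Φ N) (canonicalDensity (Torus.geometry (Fin 3)) (ε N) (n N)
          (localGibbsProfile (fun _ => abar) (fun _ => ubar) (fun _ => θe)))
        {z | speedCapOn (Φ N) z (Set.Icc s (s + τ)) ((n N : ℝ) ^ (1 / 24 : ℝ)) ∧
             packCapOn (Φ N) z (Set.Icc s (s + τ)) (mesoRadius (n N)) σ η₁ ∧
             momentCapOn (Φ N) z (Set.Icc s (s + τ)) K ∧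
             δ < |momDefect σ (Φ N) z (mesoRadius (n N)) s τ ψ|}
        ≤ ENNReal.ofReal (Real.exp (-(c₀ * n N)))

/-- **S3″ — ENERGY CLOSURE TIGHTNESS AT A UNIFORM RATE UNDER THE FOURTH-MOMENT CAP** (the energy twin of S2″: the frame of
`EnergyClosureTightnessUR` with the fourth-moment cap added to the event and the rate chosen after `(M, K)`; OPEN, delegated-grade). The
drifting needle-beam witness against `EnergyClosureCost` (stmt-14426) dies under the cap for the same reason. [cite: Yau1991, §2] -/
@[conjecture] def EnergyClosureTightness4 : Prop :=
  ∃ η₁ : ℝ, 0 < η₁ ∧ ∀ M : ℝ, 1 ≤ M → ∀ K : ℝ, 0 < K → ∃ c₀ : ℝ, 0 < c₀ ∧ ∀ (abar θe : ℝ) (ubar : V3),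
    M⁻¹ ≤ abar → abar ≤ M → M⁻¹ ≤ θe → θe ≤ M → ‖ubar‖ ≤ M →
    ∃ σ₀ : ℝ, 0 < σ₀ ∧ ∀ σ : ℝ, 0 < σ → σ < σ₀ →
    ∀ (ε : ℕ → ℝ) (n : ℕ → ℕ), (∀ N, 0 < ε N) → Tendsto ε atTop (nhds 0) →
    Tendsto (fun N => (n N : ℝ) * ε N ^ 3) atTop (nhds (σ ^ 3)) →
    ∀ Φ : (N : ℕ) → HardSphereFlow (Torus.geometry (Fin 3)) (ε N) (n N),
    ∀ (s τ : ℝ), 0 ≤ s → 0 < τ → s + τ ≤ 1 →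
    ∀ φ : ℝ → T3 → ℝ, Torus.IsSmoothSpaceTimeOn (Set.Icc s (s + τ)) φ →
    (∀ r ∈ Set.Icc s (s + τ), ∀ x, |φ r x| ≤ 1 ∧ |Torus.timeDerivWithin (Set.Icc s (s + τ)) φ r x| ≤ 1 ∧
      ∀ i, |Torus.partialDeriv i (φ r) x| ≤ 1) →
    ∀ δ : ℝ, 0 < δ → ∀ᶠ N : ℕ in atTop,
      particleLaw (Φ N) (canonicalDensity (Torus.geometry (Fin 3)) (ε N) (n N)
          (localGibbsProfile (fun _ => abar) (fun _ => ubar) (fun _ => θe)))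
        {z | speedCapOn (Φ N) z (Set.Icc s (s + τ)) ((n N : ℝ) ^ (1 / 24 : ℝ)) ∧
             packCapOn (Φ N) z (Set.Icc s (s + τ)) (mesoRadius (n N)) σ η₁ ∧
             momentCapOn (Φ N) z (Set.Icc s (s + τ)) K ∧
             δ < |enDefect σ (Φ N) z (mesoRadius (n N)) s τ φ|}
        ≤ ENNReal.ofReal (Real.exp (-(c₀ * n N)))

/-- **S4d — THE FOURTH-MOMENT CAP ALONG THE TRUE LAW, PRE-SHOCK, general families** (a-priori input of skeleton v14; OPEN,
delegated-grade; the companion of the speed cap `MaxSpeedBoundPreShock` 9511 and the packing cap `NoDenseInclusions` 14425). For all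
continuous positive profiles there is `σ₀ > 0` such that for `0 < σ < σ₀`, every admissible family, every classical hs-Euler solution on
`[0,T)` and every family of flows whose canonical local Gibbs laws are probability measures tied to the Euler data at `t = 0`: for every
`t < T` and every level `K` STRICTLY above the Euler fourth velocity moment per particle `‖u‖⁴ + 10θ‖u‖² + 15θ²` everywhere on `[0,t]`
(`= E‖u + √θ Z‖⁴`, `Z` standard Gaussian on `ℝ³`; the solution has unit mass), the empirical fourth moment `n⁻¹ Σᵢ ‖vᵢ(r)‖⁴` exceeds `K`
at some `r ∈ [0,t]` with probability `→ 0`. True at `t = 0` (Gaussian velocities given the positions, exponential concentration); along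
the true law it is the pre-shock bet that no `O(n)` amount of quartic moment condenses (one-sided LLN for the quartic moment, uniformly in
time). [cite: Yau1991, §2] [cite: OllaVaradhanYau1993, §1] -/
@[conjecture] def FourthMomentCapPreShock : Prop :=
  ∀ (a₀ θ₀ : T3 → ℝ) (u₀ : T3 → V3), Continuous a₀ → Continuous θ₀ → Continuous u₀ →
    (∀ x, 0 < a₀ x) → (∀ x, 0 < θ₀ x) → ∃ σ₀ : ℝ, 0 < σ₀ ∧ ∀ σ : ℝ, 0 < σ → σ < σ₀ →
    ∀ (ε : ℕ → ℝ) (n : ℕ → ℕ), (∀ N, 0 < ε N) → Tendsto ε atTop (nhds 0) →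
    Tendsto (fun N => (n N : ℝ) * ε N ^ 3) atTop (nhds (σ ^ 3)) →
    ∀ (T : ℝ) (ρ θ : ℝ → T3 → ℝ) (u : ℝ → T3 → V3), IsHardSphereEulerSolution σ T ρ u θ →
    ∀ Φ : (N : ℕ) → HardSphereFlow (Torus.geometry (Fin 3)) (ε N) (n N),
    let P : (N : ℕ) → Measure (Config (n N) (Fin 3) T3) := fun N =>
      particleLaw (Φ N) (canonicalDensity (Torus.geometry (Fin 3)) (ε N) (n N) (localGibbsProfile a₀ u₀ θ₀));
    (∀ N, IsProbabilityMeasure (P N)) →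
    (∀ χ : T3 → ℝ, Continuous χ → ∀ δ : ℝ, 0 < δ →
      Tendsto (fun N => P N {z | δ < |empiricalDensityField ((Φ N).flow 0 z) χ - ∫ x, χ x * ρ 0 x|}) atTop (nhds 0) ∧
      Tendsto (fun N => P N {z | δ < ‖empiricalMomentumField ((Φ N).flow 0 z) χ - ∫ x, (χ x * ρ 0 x) • u 0 x‖}) atTop (nhds 0) ∧
      Tendsto (fun N => P N {z | δ < |empiricalEnergyField ((Φ N).flow 0 z) χ -
        ∫ x, χ x * totalEnergyDensity (ρ 0 x) (u 0 x) (θ 0 x)|}) atTop (nhds 0)) →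
    ∀ t ∈ Set.Ico 0 T, ∀ K : ℝ,
      (∀ s ∈ Set.Icc 0 t, ∀ x, ‖u s x‖ ^ 4 + 10 * θ s x * ‖u s x‖ ^ 2 + 15 * θ s x ^ 2 < K) →
      Tendsto (fun N => P N {z | ∃ r ∈ Set.Icc 0 t,
        K < (n N : ℝ)⁻¹ * ∑ i : Fin (n N), ‖((Φ N).flow r z i).2‖ ^ 4}) atTop (nhds 0)

/-- **THE DYNAMIC THEOREM AT FIXED DATA UNDER THE FOURTH-MOMENT CAP** (level 1 of the Grönwall assembly of skeleton v14): verbatim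
`DynamicTheorem` (`…DynamicDefs`) with (i) one more cap-failure hypothesis `hcapM` — the fourth-moment cap at level `K` fails somewhere on
`[0,t]` with probability `→ 0` along the true law — and (ii) the fourth-moment cap `momentCapOn … K` added to the conditioning events of the
two equilibrium closure bounds `hKmom` / `hKen`. Proof (file `…Dynamic4`): the landed proof of `stub_dynamic` with the good events rebuilt
(`good_event_package4`: one more conjunct in the closure events, one more cap failure in the bad event). [cite: Yau1991, §2] -/
@[conjecture] def DynamicTheorem4 : Prop :=
    ∀ {η₀ : ℝ} {F : ℝ → ℝ} (hη₀ : 0 < η₀) (hFa : AnalyticOnNhd ℝ F (Set.Ioo (-η₀) η₀))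
    (hEq : Set.EqOn hsExcessFreeEnergy F (Set.Ico 0 η₀))
    {σ T : ℝ} (hσ : 0 < σ) {ρ θ : ℝ → T3 → ℝ} {u : ℝ → T3 → V3} (hE : IsHardSphereEulerSolution σ T ρ u θ)
    {t : ℝ} (ht : t ∈ Set.Ico 0 T) (ht1 : t < 1) (hband : ∀ s ∈ Set.Icc 0 t, ∀ x, ρ s x * σ ^ 3 < η₀)
    (hmass : ∫ x, ρ 0 x = 1)
    {ηP : ℝ} (hηP : 0 < ηP) (hηP₀ : ηP < η₀)
    {ε : ℕ → ℝ} {n : ℕ → ℕ} (hn : Tendsto n atTop atTop) (hε : ∀ N, 0 < ε N)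
    (Φ : (N : ℕ) → HardSphereFlow (Torus.geometry (Fin 3)) (ε N) (n N))
    (P : (N : ℕ) → Measure (Config (n N) (Fin 3) T3))
    (hPdef : ∀ N, P N = particleLaw (Φ N) (canonicalDensity (Torus.geometry (Fin 3)) (ε N) (n N)
    (localGibbsProfile (fun x => ρ 0 x * Real.exp (gChem σ (ρ 0 x))) (u 0) (θ 0))))
    (hP : ∀ N, IsProbabilityMeasure (P N))
    {π₀ : ℝ} {πst : ℝ → ℝ}
    (hπ₀ : Tendsto (fun N => (n N : ℝ)⁻¹ * Real.log (canonicalPartition (Torus.geometry (Fin 3)) (ε N) (n N)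
    (localGibbsProfile (fun x => ρ 0 x * Real.exp (gChem σ (ρ 0 x))) (u 0) (θ 0)))) atTop (nhds π₀))
    (hπ : TendstoUniformlyOn (fun N r => (n N : ℝ)⁻¹ * Real.log (canonicalPartition (Torus.geometry (Fin 3)) (ε N) (n N)
    (localGibbsProfile (fun x => ρ r x * Real.exp (gChem σ (ρ r x))) (u r) (θ r)))) πst atTop (Set.Icc 0 t))
    (hm₀ : Tendsto (fun N => ∫ z, logProfileObs σ ρ θ u 0 z ∂(P N)) atTop
    (nhds (∫ x, ρ 0 x * (Real.log (ρ 0 x) + gChem σ (ρ 0 x) - 3 / 2 * Real.log (2 * Real.pi * θ 0 x) - 3 / 2))))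
    (hm₀i : ∀ᶠ N : ℕ in atTop, Integrable (fun z => logProfileObs σ ρ θ u 0 z) (P N))
    (hiso : ∀ r ∈ Set.Icc 0 t,
    (∫ x, ρ 0 x * (Real.log (ρ 0 x) + gChem σ (ρ 0 x) - 3 / 2 * Real.log (2 * Real.pi * θ 0 x) - 3 / 2)) - π₀ =
    (∫ x, ρ r x * (Real.log (ρ r x) + gChem σ (ρ r x) - 3 / 2 * Real.log (2 * Real.pi * θ r x) - 3 / 2)) - πst r)
    {γ : ℝ} (hγ : 0 < γ)
    (hSt2 : ∀ κ : ℝ, 0 < κ → ∀ᶠ N : ℕ in atTop, ∀ r ∈ Set.Icc 0 t,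
    ∫⁻ w, ENNReal.ofReal (Real.exp (γ * (n N : ℝ) * fluctuationE (mesoRadius (n N)) (ρ r) (θ r) (u r) w))
    ∂(particleLaw (Φ N) (canonicalDensity (Torus.geometry (Fin 3)) (ε N) (n N)
    (localGibbsProfile (fun x => ρ r x * Real.exp (gChem σ (ρ r x))) (u r) (θ r)))) ≤
    ENNReal.ofReal (Real.exp (κ * (n N : ℝ))))
    (hcapV : Tendsto (fun N => P N {z | ∃ r ∈ Set.Icc 0 t, ∃ i, (n N : ℝ) ^ (1 / 24 : ℝ) < ‖((Φ N).flow r z i).2‖})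
    atTop (nhds 0))
    (hcapP : Tendsto (fun N => P N {z | ∃ r ∈ Set.Icc 0 t, ∃ x : T3,
    ηP < empiricalDensityField ((Φ N).flow r z) (ballKernel (mesoRadius (n N)) x) * σ ^ 3}) atTop (nhds 0))
    {K : ℝ}
    (hcapM : Tendsto (fun N => P N {z | ∃ r ∈ Set.Icc 0 t,
    K < (n N : ℝ)⁻¹ * ∑ i : Fin (n N), ‖((Φ N).flow r z i).2‖ ^ 4}) atTop (nhds 0))
    {a A : ℝ} (ha : 0 < a) (hA : 0 ≤ A)
    (hgauss : ∀ᶠ N : ℕ in atTop, ∀ s ∈ Set.Icc 0 t,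
    ∫⁻ z, ENNReal.ofReal ((n N : ℝ)⁻¹ * ∑ i : Fin (n N), Real.exp (a * ‖((Φ N).flow s z i).2‖ ^ 2)) ∂(P N) ≤
    ENNReal.ofReal A)
    (G : (N : ℕ) → Measure (Config (n N) (Fin 3) T3)) {aI c₀ : ℝ} (haI : aI < c₀)
    (hImp : ∀ N (S : Set (Config (n N) (Fin 3) T3)), P N S ≤ ENNReal.ofReal (Real.exp (aI * n N)) * G N S)
    {η₂ η₃ : ℝ} (hη₂ : ηP ≤ η₂) (hη₃ : ηP ≤ η₃)
    (hKmom : ∀ (s τ : ℝ), 0 ≤ s → 0 < τ → s + τ ≤ 1 →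
    ∀ ψ : ℝ → T3 → V3, Torus.IsSmoothSpaceTimeOn (Set.Icc s (s + τ)) ψ →
    (∀ r ∈ Set.Icc s (s + τ), ∀ x, ‖ψ r x‖ ≤ 1 ∧ ‖Torus.timeDerivWithin (Set.Icc s (s + τ)) ψ r x‖ ≤ 1 ∧
    ∀ i, ‖Torus.partialDeriv i (ψ r) x‖ ≤ 1) →
    ∀ δ : ℝ, 0 < δ → ∀ᶠ N : ℕ in atTop,
    G N {z | speedCapOn (Φ N) z (Set.Icc s (s + τ)) ((n N : ℝ) ^ (1 / 24 : ℝ)) ∧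
    packCapOn (Φ N) z (Set.Icc s (s + τ)) (mesoRadius (n N)) σ η₂ ∧
    momentCapOn (Φ N) z (Set.Icc s (s + τ)) K ∧
    δ < |momDefect σ (Φ N) z (mesoRadius (n N)) s τ ψ|} ≤ ENNReal.ofReal (Real.exp (-(c₀ * n N))))
    (hKen : ∀ (s τ : ℝ), 0 ≤ s → 0 < τ → s + τ ≤ 1 →
    ∀ φ : ℝ → T3 → ℝ, Torus.IsSmoothSpaceTimeOn (Set.Icc s (s + τ)) φ →
    (∀ r ∈ Set.Icc s (s + τ), ∀ x, |φ r x| ≤ 1 ∧ |Torus.timeDerivWithin (Set.Icc s (s + τ)) φ r x| ≤ 1 ∧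
    ∀ i, |Torus.partialDeriv i (φ r) x| ≤ 1) →
    ∀ δ : ℝ, 0 < δ → ∀ᶠ N : ℕ in atTop,
    G N {z | speedCapOn (Φ N) z (Set.Icc s (s + τ)) ((n N : ℝ) ^ (1 / 24 : ℝ)) ∧
    packCapOn (Φ N) z (Set.Icc s (s + τ)) (mesoRadius (n N)) σ η₃ ∧
    momentCapOn (Φ N) z (Set.Icc s (s + τ)) K ∧
    δ < |enDefect σ (Φ N) z (mesoRadius (n N)) s τ φ|} ≤ ENNReal.ofReal (Real.exp (-(c₀ * n N)))),
    ∀ κ : ℝ, 0 < κ → ∀ᶠ N in atTop,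
    Integrable (fun z => logProfileObs σ ρ θ u t ((Φ N).flow t z)) (P N) ∧
    (∫ x, ρ t x * (Real.log (ρ t x) + gChem σ (ρ t x) - 3 / 2 * Real.log (2 * Real.pi * θ t x) - 3 / 2)) - κ ≤
    ∫ z, logProfileObs σ ρ θ u t ((Φ N).flow t z) ∂(P N)

/-! ## The re-typed K-stubs are weaker than the old ones -/

/-- **S2 ⇒ S2″**: the old momentum K-stub implies the re-typed one (the new event is contained in the old one and the old rate does
not depend on the cap level). [folklore] -/
theorem momentumClosureTightness4_of_UR : MomentumClosureTightnessUR → MomentumClosureTightness4 := by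
  intro h
  obtain ⟨η₁, hη₁, H⟩ := momentumClosureTightnessUR_iff.1 h
  refine ⟨η₁, hη₁, fun M hM K _ => ?_⟩
  obtain ⟨c₀, hc₀, H'⟩ := H M hM
  refine ⟨c₀, hc₀, fun abar θe ubar h1 h2 h3 h4 h5 => ?_⟩
  obtain ⟨σ₀, hσ₀, H''⟩ := H' abar θe ubar h1 h2 h3 h4 h5
  refine ⟨σ₀, hσ₀, fun σ hσ hσ' ε n hε hε0 hn Φ s τ hs hτ hst ψ hψ hψb δ hδ => ?_⟩
  exact (H'' σ hσ hσ' ε n hε hε0 hn Φ s τ hs hτ hst ψ hψ hψb δ hδ).mono fun N hN => by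
    refine le_trans (measure_mono fun z hz => ?_) hN
    simp only [Set.mem_setOf_eq] at hz ⊢
    exact ⟨hz.1, hz.2.1, hz.2.2.2⟩

/-- **S3 ⇒ S3″** likewise. [folklore] -/
theorem energyClosureTightness4_of_UR : EnergyClosureTightnessUR → EnergyClosureTightness4 := by
  intro h
  obtain ⟨η₁, hη₁, H⟩ := energyClosureTightnessUR_iff.1 h
  refine ⟨η₁, hη₁, fun M hM K _ => ?_⟩
  obtain ⟨c₀, hc₀, H'⟩ := H M hM
  refine ⟨c₀, hc₀, fun abar θe ubar h1 h2 h3 h4 h5 => ?_⟩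
  obtain ⟨σ₀, hσ₀, H''⟩ := H' abar θe ubar h1 h2 h3 h4 h5
  refine ⟨σ₀, hσ₀, fun σ hσ hσ' ε n hε hε0 hn Φ s τ hs hτ hst φ hφ hφb δ hδ => ?_⟩
  exact (H'' σ hσ hσ' ε n hε hε0 hn Φ s τ hs hτ hst φ hφ hφb δ hδ).mono fun N hN => by
    refine le_trans (measure_mono fun z hz => ?_) hN
    simp only [Set.mem_setOf_eq] at hz ⊢
    exact ⟨hz.1, hz.2.1, hz.2.2.2⟩

end Summit.AtomisticToContinuum.HydrodynamicLimit.Theorems.NearConstantShortTimeHL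

end
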